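import Summits.ABC.ABC.Theorems.SparseGoodScales.Negative.CoverChain
import Summits.ABC.ABC.Theorems.SparseGoodScales.Negative.ScaleCensus
import Summits.ABC.ABC.Theorems.ScaleSubmultiplicativity.Negative.SmallScales
import Summits.ABC.ABC.Theorems.FeketeScalesSubmultOfRST
import Literature.NumberTheory.DiophantineGeometry.AbcValuationProduct

/-!
# `SparseGoodScales` (stmt-ABC-2161): the exponent-`1` bad scales are EXACTLY `{6, 7, 8} ∪ [30, ∞)`

Negative support lemma for the crux `Summit.ABC.ABC.Theses.FeketeScales.SparseGoodScales`
(lead seat c5), completing the `δ = 0` picture: with `G(R) = max {c : (a, b, c) abc triple, rad ≤ R}`,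

  `G(R) > R  ↔  R ∈ {6, 7, 8} ∨ R ≥ 30`     (`badScale_one_iff`),
  `GoodScale 0 R  ↔  R ≤ 5 ∨ 9 ≤ R ≤ 29`    (`goodScale_zero_iff`).

The direction `R ≥ 30 ⟹ bad` is `Negative/CoverChain.lean` (`badScale_from_thirty`); `R ∈ [6, 8]` is bad
by `(1, 8, 9)`.  The converse is the census of the abc triples of radical `≤ 29` — REUSED from the sister
crux's negative lane, `ScaleSubmultiplicativity.c_le_nine_of_rad_le` (`Theorems/ScaleSubmultiplicativity/
Negative/SmallScales.lean`: `2 ∣ abc`, two distinct odd primes force `rad ≥ 30`, shapes `(1, 2^i, q^j)`,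
`(1, q^j, 2^i)` with `q ≤ 13`, Levi ben Gerson–type unit equations; the same equations are solved in iff-form
in `Negative/UnitEquations.lean`) — plus the census at radical `≤ 5` proved here (`c_le_two_of_rad_le_five`:
only `(1, 1, 2)`).
-/

namespace Summit.ABC.ABC.Theorems.SparseGoodScales.Negative

open Literature.NumberTheory.DiophantineGeometry UniqueFactorizationMonoid

/-! ## Primes in the radical -/

/-- A prime factor of `n ≠ 0` divides `radical n`. [folklore] -/
theorem prime_dvd_radical {p n : ℕ} (hp : p.Prime) (hn : n ≠ 0) (h : p ∣ n) : p ∣ radical n := by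
  rw [Nat.radical_eq_prod_primeFactors]
  exact Finset.dvd_prod_of_mem _ (Nat.mem_primeFactors.mpr ⟨hp, h, hn⟩)

/-- A prime dividing two coprime numbers is absurd. [folklore] -/
theorem not_dvd_of_coprime {p m n : ℕ} (hp : p.Prime) (hmn : Nat.Coprime m n) (hm : p ∣ m)
    (hn : p ∣ n) : False := by
  have h1 : p ∣ Nat.gcd m n := Nat.dvd_gcd hm hn
  rw [hmn.gcd_eq_one] at h1
  exact hp.one_lt.ne' (Nat.dvd_one.mp h1)

/-- **Odd primes cost a factor `2p` in the radical**: if an odd prime `p` divides `abc` then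
`2p ≤ rad(abc)`. [folklore] -/
theorem two_mul_le_rad {a b c p : ℕ} (h : IsABCTriple a b c) (hp : p.Prime) (hp2 : p ≠ 2)
    (hpd : p ∣ a * b * c) : 2 * p ≤ rad a b c := by
  have hn := h.mul_ne_zero
  have h2 : 2 ∣ radical (a * b * c) :=
    prime_dvd_radical Nat.prime_two hn (ScaleSubmultiplicativity.two_dvd_mul a b c h.2.2.1)
  have hpr : p ∣ radical (a * b * c) := prime_dvd_radical hp hn hpd
  have hcop : Nat.Coprime 2 p := (Nat.coprime_primes Nat.prime_two hp).mpr (Ne.symm hp2)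
  rw [rad_def]
  exact Nat.le_of_dvd (Nat.radical_pos _) (hcop.mul_dvd_of_dvd_of_dvd h2 hpr)

/-- **Census of the abc triples of radical `≤ 5`**: only `(1, 1, 2)`, so `c = 2`. [folklore] -/
theorem c_le_two_of_rad_le_five {a b c : ℕ} (h : IsABCTriple a b c) (hr : rad a b c ≤ 5) :
    c ≤ 2 := by
  -- no odd prime divides `abc`
  have hodd : ∀ {d : ℕ}, d.Prime → d ∣ a * b * c → d = 2 := by
    intro d hd hdn
    by_contra hd2
    have := two_mul_le_rad h hd hd2 hdn
    have := hd.two_le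
    omega
  obtain ⟨ha, hb, hab, hcop⟩ := h
  -- `a = 1`: otherwise a prime factor of `a` is `2`, and likewise for `b` or `c`
  have key : ∀ {x : ℕ}, x ∣ a * b * c → x ≠ 1 → 2 ∣ x := by
    intro x hx hx1
    obtain ⟨p, hp, hpx⟩ := Nat.exists_prime_and_dvd hx1
    have := hodd hp (hpx.trans hx)
    subst this
    exact hpx
  have hda : a ∣ a * b * c := ⟨b * c, by ring⟩
  have hdb : b ∣ a * b * c := ⟨a * c, by ring⟩
  have hdc : c ∣ a * b * c := ⟨a * b, by ring⟩
  by_contra hc2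
  push Not at hc2
  have h2c : 2 ∣ c := key hdc (by omega)
  -- then `a`, `b` are both odd (coprime, sum even), hence both `1`
  have ha1 : a = 1 := by
    by_contra ha1
    have h2a : 2 ∣ a := key hda ha1
    have h2b : 2 ∣ b := by omega
    exact not_dvd_of_coprime Nat.prime_two hcop h2a h2b
  have hb1 : b = 1 := by
    by_contra hb1
    have h2b : 2 ∣ b := key hdb hb1
    have h2a : 2 ∣ a := by omega
    exact not_dvd_of_coprime Nat.prime_two hcop h2a h2b
  omega

/-! ## The exact set of exponent-`1` bad scales -/

/-- **Exponent-`1` bad scales, exactly**: some abc triple has `rad(abc) ≤ R < c` if and only if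
`R ∈ {6, 7, 8}` or `R ≥ 30`. [folklore] -/
theorem badScale_one_iff (R : ℕ) :
    (∃ a b c : ℕ, IsABCTriple a b c ∧ rad a b c ≤ R ∧ R < c) ↔ (6 ≤ R ∧ R ≤ 8) ∨ 30 ≤ R := by
  constructor
  · rintro ⟨a, b, c, ht, hr, hc⟩
    have h2 := SubmultOfRST.two_le_rad ht
    by_contra hcon
    push Not at hcon
    obtain ⟨h68, hR30⟩ := hcon
    rcases Nat.lt_or_ge R 6 with hR6 | hR6
    · -- `R ≤ 5`: `rad ≤ 5`, so `c = 2 ≤ R` unless `R ≤ 1 < 2 ≤ rad`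
      have hc2 := c_le_two_of_rad_le_five ht (by omega)
      omega
    · -- `9 ≤ R ≤ 29`: `rad ≤ 29`, so `c ≤ 9 ≤ R`
      have hR9 : 9 ≤ R := by have := h68 hR6; omega
      have hc9 := ScaleSubmultiplicativity.c_le_nine_of_rad_le ht (by omega)
      omega
  · rintro (⟨h6, h8⟩ | h30)
    · refine ⟨1, 8, 9, ⟨by norm_num, by norm_num, by norm_num, by norm_num⟩, ?_, by omega⟩
      rw [PrimePowerRadical.Negative.rad_one_eight_nine]; exact h6
    · exact badScale_from_thirty R h30

/-- **Exponent-`1` good scales, exactly** (`GoodScale` of `Negative/ScaleCensus.lean` at `δ = 0`):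
every abc triple with `rad ≤ R` has `c ≤ R ^ (1 + 0)` if and only if `R ≤ 5` or `9 ≤ R ≤ 29`.  So the
`δ = 0` instance of the crux fails with everything explicit: the last good scale is `R = 29`. [folklore] -/
theorem goodScale_zero_iff (R : ℕ) : GoodScale 0 R ↔ R ≤ 5 ∨ (9 ≤ R ∧ R ≤ 29) := by
  have key : GoodScale 0 R ↔ ¬ ∃ a b c : ℕ, IsABCTriple a b c ∧ rad a b c ≤ R ∧ R < c := by
    constructor
    · rintro hg ⟨a, b, c, ht, hr, hc⟩
      have h1 := hg a b c ht hr
      rw [add_zero, Real.rpow_one] at h1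
      have h2 : (c : ℝ) ≤ R := h1
      have : c ≤ R := by exact_mod_cast h2
      omega
    · intro hn a b c ht hr
      rw [add_zero, Real.rpow_one]
      have : c ≤ R := by
        by_contra hlt
        exact hn ⟨a, b, c, ht, hr, by omega⟩
      exact_mod_cast this
  rw [key, badScale_one_iff]
  omega

end Summit.ABC.ABC.Theorems.SparseGoodScales.Negative
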